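/-
Origin: expansion seat `planner-pub-hodgecm-toy-g2-0`, handover #4 2026-08-18T06:29:50Z (`HOME/pub-hodgecm-toy-g2/lean/ToyG2/BlockGram.lean`, md5 95242626, 432 lines);
landed by the gen-7 packager in gate run 25 as `HodgeCM/Model/ToyG2/BlockGram.lean` (verbatim).
-/
/-
Copyright: HodgeCMPerL referee-model cell (toy lineage, generation 2).  Lean 4 / Mathlib only.
-/
import Mathlib

/-!
# ToyG2 — the positive block: an explicit Gram map for the period form of one quadruple of CM types

Abstract form of DESIGN.md §3 (`HOME/pub-hodgecm-toy-g2/DESIGN.md`).  Data (`BlockData`): a finite set `E` of "embeddings"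
with a "conjugation" `c`, four "CM types" `Θ i ⊆ E`, real weights `s i : E → ℝ` positive exactly on `Θ i`, odd under `c`, with the
multiplicative pair-sum identity `s 0 * s 1 = s 2 * s 3`, coupling constants `β k` with `β k θ ^ 2 = (s 2 θ * s 3 θ) ^ 2`, and `d ≥ 1`.

The period form of the block (the matrix `B` of DESIGN.md §3 on the basis `W = Fin 3 × Bool × E × E` of
`⊕_{a<b} H¹⁰(A_a) ⊗ H¹⁰(A_b)`; the six pair-shapes `(a,b)` are indexed by a couple `k : Fin 3` and a role `r : Bool`,
`(k,false)/(k,true) = (2,3)/(0,1), (0,2)/(1,3), (0,3)/(1,2)`) is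

* diagonal `D u = coef · s_a(θ) · s_b(θ')`, and
* off-diagonal `C u v`: ONLY between the partners `fst k θ = (k,false,θ,τ_k θ)` and `sec k θ = (k,true,τ_k θ,θ)` (`τ₀ = id`,
  `τ₁ = τ₂ = c`), with value `β k θ`, when both partners are basis vectors (`P k θ`).

Main results: an explicit map `g : W → (W ⊕ (Fin 3 × E) → ℝ)` with
`∑ x, g u x * g u x = D u` (`inner_self`, valid `u`), `∑ x, g u x * g v x = C u v` (`inner_of_ne`, `u ≠ v`) — so the period matrix is a
Gram matrix, i.e. positive semi-definite — together with the KERNEL RELATION `g (sec 0 ι) = (β 0 ι / α 0 ι) • g (fst 0 ι)`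
(`g_sec_zero_eq_smul`) and `g (fst k θ) ≠ 0` (`g_fst_ne_zero`).  These are exactly the facts the generation-2 theta realisation needs
for `inner_Λ`, `gen12`/`real34` (via `Perl34.C2_thm37`) and `lineField`.

No placeholders, no new axioms.
-/

noncomputable section

namespace HodgeCM.ToyG2

open Finset

/-- First slot `a` of the pair-shape `(a,b)` with couple `k` and role `r`. -/
def sh₁ : Fin 3 → Bool → Fin 4
  | 0, false => 2 | 0, true => 0 | 1, false => 0 | 1, true => 1 | 2, false => 0 | 2, true => 1

/-- Second slot `b` of the pair-shape `(a,b)` with couple `k` and role `r`. -/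
def sh₂ : Fin 3 → Bool → Fin 4
  | 0, false => 3 | 0, true => 1 | 1, false => 2 | 1, true => 3 | 2, false => 3 | 2, true => 2

/-- The data of one block (DESIGN.md §3, abstracted). -/
structure BlockData (E : Type) [Fintype E] [DecidableEq E] where
  /-- "complex conjugation" on embeddings -/
  c : E → E
  /-- the four CM types -/
  Θ : Fin 4 → Finset E
  /-- the weights `s i θ = Im θ(ξ_i)` -/
  s : Fin 4 → E → ℝ
  s_pos_iff : ∀ i θ, 0 < s i θ ↔ θ ∈ Θ i
  s_c : ∀ i θ, s i (c θ) = -s i θ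
  /-- multiplicative pair-sum identity (`ξ₀ξ₁ = ξ₂ξ₃`) -/
  s_mul : ∀ θ, s 0 θ * s 1 θ = s 2 θ * s 3 θ
  /-- the three coupling functions (`± t · s₂ s₃`) -/
  β : Fin 3 → E → ℝ
  β_sq : ∀ k θ, β k θ ^ 2 = (s 2 θ * s 3 θ) ^ 2
  /-- the cross-pair coefficient -/
  d : ℝ
  one_le_d : 1 ≤ d

/-- The basis index type `W = Fin 3 × Bool × E × E` (couple, role, θ, θ'). -/
abbrev W (E : Type) := Fin 3 × Bool × E × E

namespace BlockData

variable {E : Type} [Fintype E] [DecidableEq E] (X : BlockData E)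

/-- the twist `τ₀ = id`, `τ₁ = τ₂ = c` -/
def τ (k : Fin 3) (θ : E) : E := if k = 0 then θ else X.c θ

/-- pair coefficient: `1` on the couple `(0,1)/(2,3)`, `d` on the two cross couples -/
def coef (k : Fin 3) : ℝ := if k = 0 then 1 else X.d

/-- diagonal entry -/
def D (u : W E) : ℝ := X.coef u.1 * X.s (sh₁ u.1 u.2.1) u.2.2.1 * X.s (sh₂ u.1 u.2.1) u.2.2.2

/-- first partner of couple `k` at `θ` -/
def fst (k : Fin 3) (θ : E) : W E := (k, false, θ, X.τ k θ)

/-- second partner of couple `k` at `θ` -/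
def sec (k : Fin 3) (θ : E) : W E := (k, true, X.τ k θ, θ)

/-- `u` is a genuine basis vector (`θ ∈ Θ_a`, `θ' ∈ Θ_b`) -/
def valid (u : W E) : Prop := u.2.2.1 ∈ X.Θ (sh₁ u.1 u.2.1) ∧ u.2.2.2 ∈ X.Θ (sh₂ u.1 u.2.1)

/-- (Ported verbatim from the HodgeCMPerL package; no docstring in the source.) -/
instance (u : W E) : Decidable (X.valid u) := inferInstanceAs (Decidable (_ ∧ _))

/-- both partners of couple `k` at `θ` are basis vectors -/
def P (k : Fin 3) (θ : E) : Prop := X.valid (X.fst k θ) ∧ X.valid (X.sec k θ)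

/-- (Ported verbatim from the HodgeCMPerL package; no docstring in the source.) -/
instance (k : Fin 3) (θ : E) : Decidable (X.P k θ) := inferInstanceAs (Decidable (_ ∧ _))

/-- `α = D (fst)` -/
def α (k : Fin 3) (θ : E) : ℝ := X.D (X.fst k θ)

/-- off-diagonal part of the period matrix -/
def C (u v : W E) : ℝ :=
  ∑ k : Fin 3, ∑ θ : E, if X.P k θ then
    X.β k θ * ((if u = X.fst k θ ∧ v = X.sec k θ then 1 else 0) + (if u = X.sec k θ ∧ v = X.fst k θ then 1 else 0))
    else 0

/-- shared coordinates of the Gram vectors (one per coupled pair) -/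
def shared (u : W E) (p : Fin 3 × E) : ℝ :=
  if X.P p.1 p.2 then
    (if u = X.fst p.1 p.2 then Real.sqrt (X.α p.1 p.2) else 0) +
    (if u = X.sec p.1 p.2 then X.β p.1 p.2 / Real.sqrt (X.α p.1 p.2) else 0)
  else 0

/-- residual private diagonal -/
def ρ (u : W E) : ℝ :=
  if u.2.1 = false then (if u.2.2.2 = X.τ u.1 u.2.2.1 ∧ X.P u.1 u.2.2.1 then 0 else X.D u)
  else (if u.2.2.1 = X.τ u.1 u.2.2.2 ∧ X.P u.1 u.2.2.2 then X.D u - X.β u.1 u.2.2.2 ^ 2 / X.α u.1 u.2.2.2 else X.D u)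

/-- the Gram vectors -/
def g (u : W E) : (W E ⊕ (Fin 3 × E)) → ℝ :=
  Sum.elim (fun x => if x = u then Real.sqrt (X.ρ u) else 0) (X.shared u)

/-! ### elementary facts -/

/-- (Ported verbatim from the HodgeCMPerL package; no docstring in the source.) -/
theorem coef_pos (k : Fin 3) : 0 < X.coef k := by
  unfold coef; split_ifs
  · exact one_pos
  · linarith [X.one_le_d]

/-- (Ported verbatim from the HodgeCMPerL package; no docstring in the source.) -/
theorem one_le_coef_sq (k : Fin 3) : 1 ≤ X.coef k ^ 2 := by
  unfold coef; split_ifs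
  · norm_num
  · nlinarith [X.one_le_d]

/-- (Ported verbatim from the HodgeCMPerL package; no docstring in the source.) -/
theorem s_pos {i : Fin 4} {θ : E} (h : θ ∈ X.Θ i) : 0 < X.s i θ := (X.s_pos_iff i θ).mpr h

/-- (Ported verbatim from the HodgeCMPerL package; no docstring in the source.) -/
theorem D_pos {u : W E} (hu : X.valid u) : 0 < X.D u := by
  unfold D
  exact mul_pos (mul_pos (X.coef_pos _) (X.s_pos hu.1)) (X.s_pos hu.2)

/-- (Ported verbatim from the HodgeCMPerL package; no docstring in the source.) -/
theorem α_pos {k : Fin 3} {θ : E} (h : X.P k θ) : 0 < X.α k θ := X.D_pos h.1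

/-- (Ported verbatim from the HodgeCMPerL package; no docstring in the source.) -/
theorem fst_ne_sec (k k' : Fin 3) (θ θ' : E) : X.fst k θ ≠ X.sec k' θ' := by
  simp [fst, sec]

/-- (Ported verbatim from the HodgeCMPerL package; no docstring in the source.) -/
theorem sec_ne_fst (k k' : Fin 3) (θ θ' : E) : X.sec k θ ≠ X.fst k' θ' := fun h => X.fst_ne_sec k' k θ' θ h.symm

/-- (Ported verbatim from the HodgeCMPerL package; no docstring in the source.) -/
theorem fst_inj {k k' : Fin 3} {θ θ' : E} : X.fst k θ = X.fst k' θ' ↔ k = k' ∧ θ = θ' := by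
  constructor
  · intro h
    simp only [fst, Prod.mk.injEq] at h
    exact ⟨h.1, h.2.2.1⟩
  · rintro ⟨rfl, rfl⟩; rfl

/-- (Ported verbatim from the HodgeCMPerL package; no docstring in the source.) -/
theorem sec_inj {k k' : Fin 3} {θ θ' : E} : X.sec k θ = X.sec k' θ' ↔ k = k' ∧ θ = θ' := by
  constructor
  · intro h
    simp only [sec, Prod.mk.injEq] at h
    exact ⟨h.1, h.2.2.2⟩
  · rintro ⟨rfl, rfl⟩; rfl

/-- `α · γ = coef² · (s₂ s₃)²` for the two partners of a couple (uses `s₀s₁ = s₂s₃` and oddness of `s`). -/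
theorem α_mul_D_sec (k : Fin 3) (θ : E) :
    X.α k θ * X.D (X.sec k θ) = X.coef k ^ 2 * (X.s 2 θ * X.s 3 θ) ^ 2 := by
  have h := X.s_mul θ
  fin_cases k
  · simp [α, D, fst, sec, sh₁, sh₂, τ, coef]
    linear_combination (X.s 2 θ * X.s 3 θ) * h
  · simp [α, D, fst, sec, sh₁, sh₂, τ, coef, X.s_c]
    linear_combination (X.d ^ 2 * X.s 2 θ * X.s 3 θ) * h
  · simp [α, D, fst, sec, sh₁, sh₂, τ, coef, X.s_c]
    linear_combination (X.d ^ 2 * X.s 2 θ * X.s 3 θ) * h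

/-- (Ported verbatim from the HodgeCMPerL package; no docstring in the source.) -/
theorem β_sq_le (k : Fin 3) (θ : E) : X.β k θ ^ 2 ≤ X.α k θ * X.D (X.sec k θ) := by
  rw [X.α_mul_D_sec, X.β_sq]
  have := X.one_le_coef_sq k
  nlinarith [sq_nonneg (X.s 2 θ * X.s 3 θ)]

/-- (Ported verbatim from the HodgeCMPerL package; no docstring in the source.) -/
theorem β_zero_sq_eq (θ : E) : X.β 0 θ ^ 2 = X.α 0 θ * X.D (X.sec 0 θ) := by
  rw [X.α_mul_D_sec, X.β_sq]; simp [coef]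

/-- (Ported verbatim from the HodgeCMPerL package; no docstring in the source.) -/
theorem ρ_fst {k : Fin 3} {θ : E} (h : X.P k θ) : X.ρ (X.fst k θ) = 0 := by
  simp [ρ, fst, h]

/-- (Ported verbatim from the HodgeCMPerL package; no docstring in the source.) -/
theorem ρ_sec {k : Fin 3} {θ : E} (h : X.P k θ) :
    X.ρ (X.sec k θ) = X.D (X.sec k θ) - X.β k θ ^ 2 / X.α k θ := by
  simp [ρ, sec, h]

/-- (Ported verbatim from the HodgeCMPerL package; no docstring in the source.) -/
theorem ρ_nonneg {u : W E} (hu : X.valid u) : 0 ≤ X.ρ u := by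
  have hD := X.D_pos hu
  unfold ρ
  split_ifs with h1 h2 h3
  · exact le_refl 0
  · exact hD.le
  · -- `u = sec k θ'`: `D - β²/α = (αγ - β²)/α ≥ 0`
    obtain ⟨k, r, θ₁, θ₂⟩ := u
    simp only at h1 h3 hD ⊢
    obtain ⟨rfl, hP⟩ := h3
    have hr : r = true := by simpa using h1
    subst hr
    have hα := X.α_pos hP
    have hle := X.β_sq_le k θ₂
    have hsec : X.sec k θ₂ = (k, true, X.τ k θ₂, θ₂) := rfl
    rw [hsec] at hle
    rw [sub_nonneg, div_le_iff₀ hα]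
    linarith
  · exact hD.le

/-! ### collapsing the sums over couples -/

/-- (Ported verbatim from the HodgeCMPerL package; no docstring in the source.) -/
theorem sum_ite_fst (F : Fin 3 → E → ℝ) (u : W E) :
    (∑ k : Fin 3, ∑ θ : E, if u = X.fst k θ then F k θ else 0) =
      if u.2.1 = false ∧ u.2.2.2 = X.τ u.1 u.2.2.1 then F u.1 u.2.2.1 else 0 := by
  obtain ⟨k₀, r, θ₁, θ₂⟩ := u
  have key : ∀ (k : Fin 3) (θ : E), (((k₀, r, θ₁, θ₂) : W E) = X.fst k θ) ↔
      (k = k₀ ∧ (θ = θ₁ ∧ (r = false ∧ θ₂ = X.τ k₀ θ₁))) := by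
    intro k θ
    simp only [fst, Prod.mk.injEq]
    constructor
    · rintro ⟨rfl, rfl, rfl, rfl⟩; exact ⟨rfl, rfl, rfl, rfl⟩
    · rintro ⟨rfl, rfl, rfl, rfl⟩; exact ⟨rfl, rfl, rfl, rfl⟩
  simp_rw [key, ite_and]
  simp [Finset.sum_ite_eq']

/-- (Ported verbatim from the HodgeCMPerL package; no docstring in the source.) -/
theorem sum_ite_sec (F : Fin 3 → E → ℝ) (u : W E) :
    (∑ k : Fin 3, ∑ θ : E, if u = X.sec k θ then F k θ else 0) =
      if u.2.1 = true ∧ u.2.2.1 = X.τ u.1 u.2.2.2 then F u.1 u.2.2.2 else 0 := by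
  obtain ⟨k₀, r, θ₁, θ₂⟩ := u
  have key : ∀ (k : Fin 3) (θ : E), (((k₀, r, θ₁, θ₂) : W E) = X.sec k θ) ↔
      (k = k₀ ∧ (θ = θ₂ ∧ (r = true ∧ θ₁ = X.τ k₀ θ₂))) := by
    intro k θ
    simp only [sec, Prod.mk.injEq]
    constructor
    · rintro ⟨rfl, rfl, rfl, rfl⟩; exact ⟨rfl, rfl, rfl, rfl⟩
    · rintro ⟨rfl, rfl, rfl, rfl⟩; exact ⟨rfl, rfl, rfl, rfl⟩
  simp_rw [key, ite_and]
  simp [Finset.sum_ite_eq']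

/-! ### the Gram identities -/

/-- (Ported verbatim from the HodgeCMPerL package; no docstring in the source.) -/
theorem shared_mul_shared_of_ne {u v : W E} (huv : u ≠ v) (p : Fin 3 × E) :
    X.shared u p * X.shared v p =
      if X.P p.1 p.2 then X.β p.1 p.2 *
        ((if u = X.fst p.1 p.2 ∧ v = X.sec p.1 p.2 then 1 else 0) +
         (if u = X.sec p.1 p.2 ∧ v = X.fst p.1 p.2 then 1 else 0)) else 0 := by
  unfold shared
  by_cases hP : X.P p.1 p.2
  · have hα := X.α_pos hP
    have hsq : Real.sqrt (X.α p.1 p.2) ≠ 0 := (Real.sqrt_pos.mpr hα).ne'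
    simp only [hP, if_true]
    by_cases hu1 : u = X.fst p.1 p.2
    · have hu2 : u ≠ X.sec p.1 p.2 := by rw [hu1]; exact X.fst_ne_sec _ _ _ _
      have hv1 : v ≠ X.fst p.1 p.2 := fun h => huv (hu1.trans h.symm)
      by_cases hv2 : v = X.sec p.1 p.2
      · simp [hu1, hv2, X.fst_ne_sec, X.sec_ne_fst]
        field_simp
      · simp [hu1, hv1, hv2, X.fst_ne_sec]
    · by_cases hu2 : u = X.sec p.1 p.2
      · have hv2 : v ≠ X.sec p.1 p.2 := fun h => huv (hu2.trans h.symm)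
        by_cases hv1 : v = X.fst p.1 p.2
        · simp [hu2, hv1, X.fst_ne_sec, X.sec_ne_fst]
          field_simp
        · simp [hu2, hv1, hv2, X.sec_ne_fst]
      · simp [hu1, hu2]
  · simp [hP]

/-- (Ported verbatim from the HodgeCMPerL package; no docstring in the source.) -/
theorem shared_sq (u : W E) (p : Fin 3 × E) :
    X.shared u p * X.shared u p =
      (if u = X.fst p.1 p.2 then (if X.P p.1 p.2 then X.α p.1 p.2 else 0) else 0) +
      (if u = X.sec p.1 p.2 then (if X.P p.1 p.2 then X.β p.1 p.2 ^ 2 / X.α p.1 p.2 else 0) else 0) := by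
  unfold shared
  by_cases hP : X.P p.1 p.2
  · have hα := X.α_pos hP
    have hsq : Real.sqrt (X.α p.1 p.2) ≠ 0 := (Real.sqrt_pos.mpr hα).ne'
    simp only [hP, if_true]
    by_cases hu1 : u = X.fst p.1 p.2
    · have hu2 : u ≠ X.sec p.1 p.2 := by rw [hu1]; exact X.fst_ne_sec _ _ _ _
      simp [hu1, X.fst_ne_sec, Real.mul_self_sqrt hα.le]
    · by_cases hu2 : u = X.sec p.1 p.2
      · simp [hu2, X.sec_ne_fst]
        rw [div_mul_div_comm, Real.mul_self_sqrt hα.le, pow_two]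
      · simp [hu1, hu2]
  · simp [hP]

/-- (Ported verbatim from the HodgeCMPerL package; no docstring in the source.) -/
theorem sum_shared_sq (u : W E) :
    (∑ p : Fin 3 × E, X.shared u p * X.shared u p) =
      (if u.2.1 = false ∧ u.2.2.2 = X.τ u.1 u.2.2.1 then
          (if X.P u.1 u.2.2.1 then X.α u.1 u.2.2.1 else 0) else 0) +
      (if u.2.1 = true ∧ u.2.2.1 = X.τ u.1 u.2.2.2 then
          (if X.P u.1 u.2.2.2 then X.β u.1 u.2.2.2 ^ 2 / X.α u.1 u.2.2.2 else 0) else 0) := by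
  simp_rw [X.shared_sq]
  rw [Finset.sum_add_distrib, Fintype.sum_prod_type, Fintype.sum_prod_type]
  rw [X.sum_ite_fst (fun k θ => if X.P k θ then X.α k θ else 0) u,
    X.sum_ite_sec (fun k θ => if X.P k θ then X.β k θ ^ 2 / X.α k θ else 0) u]

/-- (Ported verbatim from the HodgeCMPerL package; no docstring in the source.) -/
theorem ρ_add_sum_shared_sq (u : W E) :
    X.ρ u + ∑ p : Fin 3 × E, X.shared u p * X.shared u p = X.D u := by
  rw [X.sum_shared_sq]
  obtain ⟨k, r, θ₁, θ₂⟩ := u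
  cases r
  · -- role `false`: `u` can only be a first partner
    simp only [ρ, Bool.false_eq_true]
    by_cases h : θ₂ = X.τ k θ₁
    · by_cases hP : X.P k θ₁
      · have hu : ((k, false, θ₁, θ₂) : W E) = X.fst k θ₁ := by rw [h]; rfl
        simp [h, hP, α, ← hu]
      · simp [h, hP]
    · simp [h]
  · simp only [ρ]
    by_cases h : θ₁ = X.τ k θ₂
    · by_cases hP : X.P k θ₂
      · simp [h, hP]
      · simp [h, hP]
    · simp [h]

/-- **Gram identity, diagonal.** -/
theorem inner_self {u : W E} (hu : X.valid u) : (∑ x, X.g u x * X.g u x) = X.D u := by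
  rw [Fintype.sum_sum_type]
  simp only [g, Sum.elim_inl, Sum.elim_inr]
  have h1 : (∑ x : W E, (if x = u then Real.sqrt (X.ρ u) else 0) * (if x = u then Real.sqrt (X.ρ u) else 0))
      = X.ρ u := by
    have : ∀ x : W E, (if x = u then Real.sqrt (X.ρ u) else 0) * (if x = u then Real.sqrt (X.ρ u) else 0)
        = if x = u then X.ρ u else 0 := by
      intro x
      split_ifs
      · exact Real.mul_self_sqrt (X.ρ_nonneg hu)
      · simp
    simp_rw [this]
    simp
  rw [h1, X.ρ_add_sum_shared_sq]

/-- **Gram identity, off-diagonal.** -/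
theorem inner_of_ne {u v : W E} (huv : u ≠ v) : (∑ x, X.g u x * X.g v x) = X.C u v := by
  rw [Fintype.sum_sum_type]
  simp only [g, Sum.elim_inl, Sum.elim_inr]
  have h1 : (∑ x : W E, (if x = u then Real.sqrt (X.ρ u) else 0) * (if x = v then Real.sqrt (X.ρ v) else 0)) = 0 := by
    refine Finset.sum_eq_zero fun x _ => ?_
    by_cases hx : x = u
    · have hxv : x ≠ v := fun h => huv (hx.symm.trans h)
      simp [hx, huv]
    · simp [hx]
  rw [h1, zero_add]
  simp_rw [X.shared_mul_shared_of_ne huv]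
  rw [C, Fintype.sum_prod_type]

/-- (Ported verbatim from the HodgeCMPerL package; no docstring in the source.) -/
theorem C_symm (u v : W E) : X.C u v = X.C v u := by
  unfold C
  refine Finset.sum_congr rfl fun k _ => Finset.sum_congr rfl fun θ _ => ?_
  by_cases hP : X.P k θ
  · simp only [hP, if_true]
    rw [add_comm]
    have e1 : (u = X.sec k θ ∧ v = X.fst k θ) ↔ (v = X.fst k θ ∧ u = X.sec k θ) := and_comm
    have e2 : (u = X.fst k θ ∧ v = X.sec k θ) ↔ (v = X.sec k θ ∧ u = X.fst k θ) := and_comm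
    simp only [e1, e2]
  · simp only [hP, if_false]


-- port_pkg: scope closed for this part
end BlockData
end HodgeCM.ToyG2
end
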